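import Summits.QuantumFields.BalabanUV.T4Continuum.Support.GaugeTermInstance
import Summits.QuantumFields.BalabanUV.T4Continuum.Support.ScalarSandwichReduction
import Summits.QuantumFields.BalabanUV.T4Continuum.Spine.NE2BalabanGauge

/-!
# T⁴ programme, spine node NE2 (U1a), tier B row B4.b — THE NUMBERS OF THE GAUGE TERM ARE GEOMETRIC, and the `hP₄` chain of ROOT B
# keyed on the scalar tower's two law bundles in the shapes rows B4.d ∕ B4.e deliver (`J0pcT ⊗ 1`)

ROUND-2 swarm `t4-ne2-formalise-*`, leaf prover 05 (GEN 2), row **B4.b**, wiring file 3.  Row B7's `Spine/NE2BalabanGauge.perturbationLaws_gaugeSlot`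
(leaf-08) consumes row B4.b's END `perturbationLaws_gaugeTerm` and asks, besides the two `LayerLaws` bundles that
`GaugeTermInstance.layerLaws_of_scalarLaws` produces from the scalar tower's laws, that their four number sequences be GEOMETRIC
(`NE2BalabanGauge.GeomNumbers`).  This file closes that bookkeeping:
 * §1 `CesS`, `CecS`, `CthetaS` and **`geomNumbers_of_defects`**: if the scalar tower's complement ∕ injected ∕ consistency defects
   `e₀, e₁, e₂` and the site-transport two-level number `δT` are `≤ C·L^{−k}`, then the sequences `esS κs e₁ e₂`, `ecS κs e₀`,
   `thetaS … (ecS κs e₀)`, `δT` of `layerLaws_of_scalarLaws` satisfy `GeomNumbers` with explicit constants (`1/n_k = L^{−k}`);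
 * §2 **`J0_eq_kron_J0pcT`**: the colour-lifted 0-form planting `GaugeTermScalarData.J0 L M o` (leaf-10's `JK0T ⊗ 1`) IS
   `fun k => ScalarPlantingDefect.J0pcT L M k ⊗ₖ 1` (leaf-04's planting; `CovariantDivergencePlantingBound.JK0_eq_planting`) — so the
   binders below are keyed LITERALLY on the shapes row B4.d (`KroneckerLift.freeTowerLaws_kron o` of `freeTowerLaws_scalar_of_excess`)
   and row B4.e (leaf-01's announced `perturbationLaws_scalarLayer`) deliver;
 * §3 **`perturbationLaws_gaugeSlot_scalar`**: the target shape IN THE SLOT FORM `PerturbationLaws (Δ_a ⊗ 1) (gaugeSlot R (Q_U) (Q_1) a′)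
   (J ⊗ 1) κ₄ (C₄·L^{−k})`, `κ₄ = kappaGS …`, `C₄ = C4S …` explicit, from `hfree : FreeTowerLaws (k ↦ DeltaPs n_k M a′ ⊗ₖ 1) A
   (k ↦ J0pcT L M k ⊗ₖ 1) F r e₀ e₁ f`, `hpert : PerturbationLaws (k ↦ DeltaPs n_k M a′ ⊗ₖ 1) (k ↦ scalarPert n_k M a′ (R k) (T k))
   (k ↦ J0pcT L M k ⊗ₖ 1) κs e₂` (`κs < 1`), geometric `e₀ e₁ e₂ δT`, the transporter numbers and `σ₀⁻²·δK < 1`;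
 * §3b `opNorm_siteMul_sub_one_le`, `opNorm_siteMul_sub_siteMul_le` and **`perturbationLaws_gaugeSlot_scalar_site`**: §3 with the
   site-transport binders ENTRYWISE (`‖T k x − 1‖ ≤ τ`, `‖T (k+1) x′ − T k (par x′)‖ ≤ τ′/n_k` — the field shapes of row B4.e's announced
   `SiteTransportLaws0`; `CT = τ′`);
 * §4 **`perturbationLaws_gaugeSlot_of_excess`**: §3 with `hfree :=` row B4.d's `ScalarSandwichReduction.freeTowerLaws_scalar_of_excess`
   BY NAME (its one displayed inequality `hX` carried as a binder; `e₀ = 2d√(γ′⁻¹)·L^{−k}`, `e₁ = (2d√(γ′⁻¹) + C_X)·L^{−k}`);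
 * the root corollaries (`NE2BalabanRoot.perturbationLaws_balaban` ∕ `balaban_rate_of_small` with `hP₄ :=` §3) are the companion file
   `Support/GaugeTermInstanceRoot`.

HONEST FRAMING (T4-DAG p. 1).  Bookkeeping + elementary inequalities, OURS; `R`, `T`, `a′` and every number are DATA ∕ hypothesis shapes
(their instances are other rows' theorems; nothing printed is a hypothesis; no `def … : Prop` fact); MODEL LEVEL, no assertion of the
dictionary B0 (c5); GLOBAL small field (`κs < 1`, `σ₀⁻²·δK < 1` displayed); CONDITIONAL on node NE3 (c2∕c7), the regularity class (c3) and
the rows' data as displayed (c4); carver's ruling c1 stands; finite torus, linear layer, operator norm; NOT [B9] (3.23)–(3.26) as printed;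
**NE2 NOT PROVED**; NOT infinite volume, NOT a mass gap, NOT Clay, NOT summit progress; spine 0/9 unchanged.  HONEST DEPENDENCY: continuum
YM on T⁴ ⇐ BetaPertH ∧ nine spine estimates (0/9 proved); BetaPertH ⇐ (D1) ∧ (D4) ∧ CAP+tail; G-an2-4 gates asym, D1 and NE2/3/4.
ABSOLUTE RULE kept; no `sorry`.
-/

noncomputable section

open scoped BigOperators ComplexConjugate Matrix Matrix.Norms.L2Operator Kronecker ComplexOrder

namespace Summit.QuantumFields.BalabanUV.T4Continuum.GaugeTermInstanceGeom

open Literature.MathematicalPhysics.QuantumFieldTheory.Balaban1983to89.B5Prop11Plancherel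
open Literature.MathematicalPhysics.QuantumFieldTheory.Balaban1983to89.B5Prop11Lower (nsq)
open Literature.MathematicalPhysics.QuantumFieldTheory.Balaban1983to89.B5Action121 (LapS)
open Literature.MathematicalPhysics.QuantumFieldTheory.Balaban1983to89.B5G183RateUnitTower (lev lev_neZero)
open Literature.MathematicalPhysics.QuantumFieldTheory.Balaban1983to89.T4EtaRateMin (LocalRate)
open Summit.QuantumFields.BalabanUV.T4Continuum
open Summit.QuantumFields.BalabanUV.T4Continuum.BalabanAveragedTowerUnit (idx Qlev one_le_lev' cast_lev')
open Summit.QuantumFields.BalabanUV.T4Continuum.CovariantAveragingTower (TowerLimitRate)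
open Summit.QuantumFields.BalabanUV.T4Continuum.BackgroundResolventTower
open Summit.QuantumFields.BalabanUV.T4Continuum.BackgroundResolventLaw
open Summit.QuantumFields.BalabanUV.T4Continuum.KingPairingPlantedLaw
open Summit.QuantumFields.BalabanUV.T4Continuum.KroneckerLift
open Summit.QuantumFields.BalabanUV.T4Continuum.BlockMultiplication
open Summit.QuantumFields.BalabanUV.T4Continuum.BalabanAveragedTowerModes (par)
open Summit.QuantumFields.BalabanUV.T4Continuum.PerturbationAlgebra (perturbationLaws_mono perturbationLaws_zero)
open Summit.QuantumFields.BalabanUV.T4Continuum.GramPerturbationLaw (AveragingLaws C2gram)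
open Summit.QuantumFields.BalabanUV.T4Continuum.NE2FromNE3 (bgReadings)
open Summit.QuantumFields.BalabanUV.T4Continuum.RegularBackgroundTower (RegularTransporters regClass)
open Summit.QuantumFields.BalabanUV.T4Continuum.CovariantBlockAveraging (Ecov)
open Summit.QuantumFields.BalabanUV.T4Continuum.CovariantAveragingSummand (kappaQ)
open Summit.QuantumFields.BalabanUV.T4Continuum.GaugeTermDecomposition (connL)
open Summit.QuantumFields.BalabanUV.T4Continuum.GaugeTermSandwichLaw
open Summit.QuantumFields.BalabanUV.T4Continuum.GaugeTermLayer
open Summit.QuantumFields.BalabanUV.T4Continuum.GaugeTermPerturbationLaw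
open Summit.QuantumFields.BalabanUV.T4Continuum.GaugeTermScalarData
open Summit.QuantumFields.BalabanUV.T4Continuum.GaugeTermInstance
open Summit.QuantumFields.BalabanUV.T4Continuum.ScalarAveragedPropagator (DeltaPs Gps gammaPs gammaPs_pos)
open Summit.QuantumFields.BalabanUV.T4Continuum.ScalarAveragedCompression (sigma0)
open Summit.QuantumFields.BalabanUV.T4Continuum.ScalarCovariantLaplacian (scalarPert)
open Summit.QuantumFields.BalabanUV.T4Continuum.ScalarPlantingDefect (Q0lev J0pcT)
open Summit.QuantumFields.BalabanUV.T4Continuum.ScalarSandwichReduction (effLapLev freeTowerLaws_scalar_of_excess)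
open Summit.QuantumFields.BalabanUV.T4Continuum.BlockPairingGeometry (tau parT)
open Summit.QuantumFields.BalabanUV.T4Continuum.CovariantDivergencePlantingTower (JK0T JK0T_eq)
open Summit.QuantumFields.BalabanUV.T4Continuum.NE2BalabanLayer
open Summit.QuantumFields.BalabanUV.T4Continuum.NE2BalabanRoot
open Summit.QuantumFields.BalabanUV.T4Continuum.NE2BalabanGauge

/-! ## §1 The number sequences of `layerLaws_of_scalarLaws` are geometric when the defects are -/

section Numbers

/-- geometric constant of `esS κs e₁ e₂` when `e₁ ≤ C₁·L^{−k}`, `e₂ ≤ C₂·L^{−k}`. [folklore] -/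
def CesS (κs C₁ C₂ : ℝ) : ℝ := (C₁ + C₂) * ((1 - κs)⁻¹) ^ 2

/-- geometric constant of `ecS κs e₀` when `e₀ ≤ C₀·L^{−k}`. [folklore] -/
def CecS (κs C₀ : ℝ) : ℝ := (1 - κs)⁻¹ * C₀

/-- geometric constant of `thetaS d L a g α β β′ ec` when `ec ≤ Cec·L^{−k}` (`1/n_k = L^{−k}`). [folklore] -/
def CthetaS (d L : ℕ) (a g α β β' Cec : ℝ) : ℝ :=
  Cec * (d * ((L : ℝ) + 1) * Cst d a) + g * (d * ((β' + 2 * (α + β)) * Cst d a))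

variable {d L : ℕ} {a g α β β' κs : ℝ} {e₀ e₁ e₂ δT : ℕ → ℝ} {C₀ C₁ C₂ CT : ℝ}

/-- `1/n_k = (L⁻¹)^k`. [folklore] -/
theorem inv_cast_lev (L k : ℕ) : ((lev L k : ℕ) : ℝ)⁻¹ = ((L : ℝ)⁻¹) ^ k := by
  rw [cast_lev', inv_pow]

/-- `esS ≤ CesS·L^{−k}`. [folklore] -/
theorem esS_le_geom (he₁ : ∀ k, e₁ k ≤ C₁ * ((L : ℝ)⁻¹) ^ k) (he₂ : ∀ k, e₂ k ≤ C₂ * ((L : ℝ)⁻¹) ^ k) (k : ℕ) :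
    esS κs e₁ e₂ k ≤ CesS κs C₁ C₂ * ((L : ℝ)⁻¹) ^ k := by
  have hν : 0 ≤ ((1 - κs)⁻¹) ^ 2 := sq_nonneg _
  unfold esS CesS
  calc (e₁ k + e₂ k) * ((1 - κs)⁻¹) ^ 2 ≤ ((C₁ + C₂) * ((L : ℝ)⁻¹) ^ k) * ((1 - κs)⁻¹) ^ 2 :=
        mul_le_mul_of_nonneg_right (by have := he₁ k; have := he₂ k; linarith) hν
    _ = (C₁ + C₂) * ((1 - κs)⁻¹) ^ 2 * ((L : ℝ)⁻¹) ^ k := by ring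

/-- `ecS ≤ CecS·L^{−k}`. [folklore] -/
theorem ecS_le_geom (hκ : κs < 1) (he₀ : ∀ k, e₀ k ≤ C₀ * ((L : ℝ)⁻¹) ^ k) (k : ℕ) :
    ecS κs e₀ k ≤ CecS κs C₀ * ((L : ℝ)⁻¹) ^ k := by
  have hν : 0 ≤ (1 - κs)⁻¹ := inv_nonneg.mpr (by linarith)
  unfold ecS CecS
  rw [mul_assoc]
  exact mul_le_mul_of_nonneg_left (he₀ k) hν

/-- `thetaS … ec ≤ CthetaS·L^{−k}` for `ec ≤ Cec·L^{−k}` (the second summand is already `·/n_k = ·L^{−k}`). [folklore] -/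
theorem thetaS_le_geom {ec : ℕ → ℝ} {Cec : ℝ} (hec : ∀ k, ec k ≤ Cec * ((L : ℝ)⁻¹) ^ k) (k : ℕ) :
    thetaS d L a g α β β' ec k ≤ CthetaS d L a g α β β' Cec * ((L : ℝ)⁻¹) ^ k := by
  have hC := Cst_nonneg d a
  have h1 : 0 ≤ d * ((L : ℝ) + 1) * Cst d a := by positivity
  have h3 : ec k * (d * ((L : ℝ) + 1) * Cst d a) ≤ (Cec * ((L : ℝ)⁻¹) ^ k) * (d * ((L : ℝ) + 1) * Cst d a) :=
    mul_le_mul_of_nonneg_right (hec k) h1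
  unfold thetaS CthetaS
  rw [div_eq_mul_inv, inv_cast_lev]
  calc ec k * (d * ((L : ℝ) + 1) * Cst d a) + g * (d * ((β' + 2 * (α + β)) * Cst d a * ((L : ℝ)⁻¹) ^ k))
      ≤ (Cec * ((L : ℝ)⁻¹) ^ k) * (d * ((L : ℝ) + 1) * Cst d a) + g * (d * ((β' + 2 * (α + β)) * Cst d a * ((L : ℝ)⁻¹) ^ k)) :=
        add_le_add h3 le_rfl
    _ = (Cec * (d * ((L : ℝ) + 1) * Cst d a) + g * (d * ((β' + 2 * (α + β)) * Cst d a))) * ((L : ℝ)⁻¹) ^ k := by ring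

/-- **THE NUMBERS ARE GEOMETRIC**: `GeomNumbers` (row B7's hypothesis shape, `Spine/NE2BalabanGauge`) for the four sequences of
`GaugeTermInstance.layerLaws_of_scalarLaws` from geometric defects `e₀ e₁ e₂ δT` (nonnegative; `κs < 1`). [folklore] -/
theorem geomNumbers_of_defects (hκ : κs < 1)
    (he₀0 : ∀ k, 0 ≤ e₀ k) (he₁0 : ∀ k, 0 ≤ e₁ k) (he₂0 : ∀ k, 0 ≤ e₂ k) (hδT0 : ∀ k, 0 ≤ δT k)
    (he₀ : ∀ k, e₀ k ≤ C₀ * ((L : ℝ)⁻¹) ^ k) (he₁ : ∀ k, e₁ k ≤ C₁ * ((L : ℝ)⁻¹) ^ k) (he₂ : ∀ k, e₂ k ≤ C₂ * ((L : ℝ)⁻¹) ^ k)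
    (hδT : ∀ k, δT k ≤ CT * ((L : ℝ)⁻¹) ^ k) :
    GeomNumbers L (esS κs e₁ e₂) (ecS κs e₀) (thetaS d L a g α β β' (ecS κs e₀)) δT
      (CesS κs C₁ C₂) (CecS κs C₀) (CthetaS d L a g α β β' (CecS κs C₀)) CT where
  es_nonneg k := by unfold esS; have := he₁0 k; have := he₂0 k; positivity
  ec_nonneg k := by
    unfold ecS; exact mul_nonneg (inv_nonneg.mpr (by linarith)) (he₀0 k)
  q₁_nonneg := hδT0
  es_le := esS_le_geom he₁ he₂
  ec_le := ecS_le_geom hκ he₀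
  θ_le := thetaS_le_geom (ecS_le_geom hκ he₀)
  q₁_le := hδT

end Numbers

/-! ## §2 The colour-lifted 0-form planting is `J0pcT ⊗ 1` -/

section Planting

variable {d : ℕ} (L : ℕ) [NeZero L] (M : Fin d → ℕ) [hM : ∀ μ, NeZero (M μ)] {o : Type*} [Fintype o] [DecidableEq o]

omit [NeZero L] hM [Fintype o] in
/-- `J0 L M o k = J0pcT L M k ⊗ 1` (leaf-10's `JK0T` and leaf-04's `J0pcT` are both `JK0 (lev L k) L M`, the two files' `JK0` agree by
`CovariantDivergencePlantingBound.JK0_eq_planting`). [folklore] -/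
theorem J0_apply_eq_kron_J0pcT (k : ℕ) : J0 L M o k = J0pcT L M k ⊗ₖ (1 : Matrix o o ℂ) := by
  rw [J0, JK0T_eq, CovariantDivergencePlantingBound.JK0_eq_planting]; rfl

omit [NeZero L] hM [Fintype o] in
/-- **`J0 L M o = fun k => J0pcT L M k ⊗ 1`** — the planting of row B4.b's END is the planting of rows B4.d ∕ B4.e. [folklore] -/
theorem J0_eq_kron_J0pcT : J0 L M o = fun k => J0pcT L M k ⊗ₖ (1 : Matrix o o ℂ) :=
  funext (J0_apply_eq_kron_J0pcT L M)

end Planting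

/-! ## §3 The gauge slot's `PerturbationLaws` from the scalar tower's two law bundles (keyed on `J0pcT ⊗ 1`) and geometric defects -/

variable {d : ℕ} (L : ℕ) [NeZero L] (M : Fin d → ℕ) [hM : ∀ μ, NeZero (M μ)] (a : ℝ) (ha : 0 < a)
variable {o : Type*} [Fintype o] [DecidableEq o]
variable (R : (k : ℕ) → Fin d → (Tor (fine (lev L k) M) → Matrix o o ℂ)) (T : (k : ℕ) → Tor (fine (lev L k) M) → Matrix o o ℂ) (a' : ℝ)

/-- the resolvent size of the perturbed scalar tower `g = γ′⁻¹(1 − κs)⁻¹`. [folklore] -/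
def gS (d : ℕ) (a' κs : ℝ) : ℝ := (gammaPs d a')⁻¹ * (1 - κs)⁻¹

/-- **`κ₄`** of the gauge slot on Bałaban's data: `kappaGT d a g (1+τ) (dα) τ a′ σ₀⁻²` with `g = gS d a′ κs`. [folklore] -/
def kappaGS (d : ℕ) (a a' κs α τ : ℝ) : ℝ := kappaGT d a (gS d a' κs) (1 + τ) (d * α) τ a' (((sigma0 d a') ^ 2)⁻¹)

/-- **`C₄`** of the gauge slot on Bałaban's data: leaf-08's `C4GT` at the geometric constants of §1 for the background family
(`CesS κs C₁ C₂`) and the free family (`CesS κs C₁ 0`). [folklore] -/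
def C4S (d L : ℕ) (a a' κs α β β' τ C₀ C₁ C₂ CT : ℝ) : ℝ :=
  C4GT d a (gS d a' κs) (1 + τ) (d * α) τ a' (((sigma0 d a') ^ 2)⁻¹)
    (CesS κs C₁ C₂) (CecS κs C₀) (CthetaS d L a (gS d a' κs) α β β' (CecS κs C₀)) CT
    (CesS κs C₁ 0) (CecS κs C₀) (CthetaS d L a (gS d a' κs) α β β' (CecS κs C₀)) CT

/-- **THE GAUGE SLOT's `PerturbationLaws` FROM THE SCALAR TOWER's LAWS** (`d ≥ 1`, `a′ > 0`), binders keyed on `J0pcT ⊗ 1`: the scalar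
tower's `FreeTowerLaws` (row B4.d's shape, lifted) and `PerturbationLaws` for `scalarPert` (row B4.e's shape), `κs < 1`, the transporter
numbers `α β β′` of the connection `n_k(R − 1)` (rows B5 ∕ B6), the site-transport numbers `τ`, `δT` (row B3.b-conc's currency), GEOMETRIC
defects `e₀ e₁ e₂ δT ≤ C·L^{−k}` and `σ₀⁻²·δK < 1` ⟹ the target shape for `gaugeSlot R Q_U Q_1 a′ = −(D_RP_UD_Rᴴ − (∂⊗1)P_1(∂⊗1)ᴴ)` with
`κ₄ = kappaGS`, `C₄ = C4S` explicit — exactly row B7's `hP₄` slot (`NE2BalabanRoot.perturbationLaws_balaban`).  NOT NE2; model level. [folklore] -/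
theorem perturbationLaws_gaugeSlot_scalar (ha' : 0 < a') (hd : 1 ≤ d)
    {A : (k : ℕ) → Matrix (Tor (fine (lev L k) M) × o) (Tor (fine (lev L (k + 1)) M) × o) ℂ}
    {F : (k : ℕ) → Matrix (Tor (fine (lev L k) M) × o) (Tor (fine (lev L k) M) × o) ℂ} {r : ℝ} {e₀ e₁ f e₂ δT : ℕ → ℝ}
    {κs α β β' τ C₀ C₁ C₂ CT : ℝ}
    (hfree : FreeTowerLaws (fun k => DeltaPs (lev L k) M a' ⊗ₖ (1 : Matrix o o ℂ)) A
      (fun k => J0pcT L M k ⊗ₖ (1 : Matrix o o ℂ)) F r e₀ e₁ f)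
    (hpert : PerturbationLaws (fun k => DeltaPs (lev L k) M a' ⊗ₖ (1 : Matrix o o ℂ))
      (fun k => scalarPert (lev L k) M a' (R k) (T k)) (fun k => J0pcT L M k ⊗ₖ (1 : Matrix o o ℂ)) κs e₂)
    (hκ : κs < 1) (hα : 0 ≤ α) (hβ : 0 ≤ β) (hβ' : 0 ≤ β') (hτ : 0 ≤ τ)
    (hR : ∀ k μ i, ‖connL (fine (lev L k) M) (cl L k) (R k) μ i‖ ≤ α)
    (hLip : ∀ k μ lam i, ‖connL (fine (lev L k) M) (cl L k) (R k) μ (tau (fine (lev L k) M) lam i)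
      - connL (fine (lev L k) M) (cl L k) (R k) μ i‖ ≤ β / (lev L k : ℕ))
    (hcons : ∀ k μ (i' : Tor (fine (lev L (k + 1)) M) × Fin d),
      ‖connL (fine (lev L (k + 1)) M) (cl L (k + 1)) (R (k + 1)) μ i' - connL (fine (lev L k) M) (cl L k) (R k) μ (parT (lev L k) L M i')‖
        ≤ β' / (lev L k : ℕ))
    (hT : ∀ k, ‖siteMul (T k) - 1‖ ≤ τ)
    (hTc : ∀ k, ‖siteMul (T (k + 1)) - siteMul (fun x' : Tor (fine (lev L (k + 1)) M) => T k (par (lev L k) L M x'))‖ ≤ δT k)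
    (he₀ : ∀ k, e₀ k ≤ C₀ * ((L : ℝ)⁻¹) ^ k) (he₁ : ∀ k, e₁ k ≤ C₁ * ((L : ℝ)⁻¹) ^ k) (he₂ : ∀ k, e₂ k ≤ C₂ * ((L : ℝ)⁻¹) ^ k)
    (hδT : ∀ k, δT k ≤ CT * ((L : ℝ)⁻¹) ^ k)
    (hsmall : ((sigma0 d a') ^ 2)⁻¹ * deltaK (gS d a' κs) (1 + τ) (d * α) τ a' < 1) :
    PerturbationLaws (fun k => calDalev L M a ha k ⊗ₖ (1 : Matrix o o ℂ)) (gaugeSlot L M R (QuT L M o T) (Q1 L M o) a')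
      (fun k => JpcT L M k ⊗ₖ (1 : Matrix o o ℂ)) (kappaGS d a a' κs α τ)
      (fun k => C4S d L a a' κs α β β' τ C₀ C₁ C₂ CT * ((L : ℝ)⁻¹) ^ k) := by
  have hJ := J0_eq_kron_J0pcT L M (o := o)
  have hfreeS : FreeTowerLaws (fun k => DeltaPs (lev L k) M a' ⊗ₖ (1 : Matrix o o ℂ)) A (J0 L M o) F r e₀ e₁ f := by
    rw [hJ]; exact hfree
  have hpertS : PerturbationLaws (fun k => DeltaPs (lev L k) M a' ⊗ₖ (1 : Matrix o o ℂ))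
      (fun k => scalarPert (lev L k) M a' (R k) (T k)) (J0 L M o) κs e₂ := by
    rw [hJ]; exact hpert
  have hκ0 : 0 ≤ κs := (norm_nonneg _).trans (hpertS.opNorm_P_mul_inv_le 0)
  have hδT0 : ∀ k, 0 ≤ δT k := fun k => (norm_nonneg _).trans (hTc k)
  have he₀0 : ∀ k, 0 ≤ e₀ k := fun k => (norm_nonneg _).trans (hfreeS.complement_le k)
  have he₁0 : ∀ k, 0 ≤ e₁ k := fun k => (norm_nonneg _).trans (hfreeS.injected_le k)
  have he₂0 : ∀ k, 0 ≤ e₂ k := fun k => (norm_nonneg _).trans (hpertS.consistent_le k)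
  -- the background family
  have hu := layerLaws_of_scalarLaws L M a ha R T a' ha' hd hfreeS hpertS hκ le_rfl hα hβ hβ' hτ hR hLip hcons hT hTc
  -- the free family: same numbers, zero connection, trivial transport
  have h₁' := layerLaws_of_scalarLaws L M a ha (oneR L M (o := o)) (fun k (_ : Tor (fine (lev L k) M)) => (1 : Matrix o o ℂ)) a' ha' hd
    hfreeS (perturbationLaws_free_scalar L M a' hκ0 (J0 L M o)) hκ le_rfl hα hβ hβ' hτ
    (fun k μ i => by rw [connL_oneR, norm_zero]; exact hα)
    (fun k μ lam i => by
      rw [connL_oneR, connL_oneR, sub_zero, norm_zero]; exact div_nonneg hβ (Nat.cast_nonneg _))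
    (fun k μ i' => by
      rw [connL_oneR, connL_oneR, sub_zero, norm_zero]; exact div_nonneg hβ' (Nat.cast_nonneg _))
    (fun k => by simp only [siteMul_one, sub_self, norm_zero]; exact hτ)
    (fun k => by simp only [siteMul_one, sub_self, norm_zero]; exact hδT0 k)
  rw [QuT_one] at h₁'
  -- both families' numbers are geometric
  have hGu := geomNumbers_of_defects (d := d) (L := L) (a := a) (g := gS d a' κs) (α := α) (β := β) (β' := β') hκ he₀0 he₁0 he₂0
    hδT0 he₀ he₁ he₂ hδT
  have hG₁ := geomNumbers_of_defects (d := d) (L := L) (a := a) (g := gS d a' κs) (α := α) (β := β) (β' := β')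
    (e₂ := fun _ => (0 : ℝ)) (C₂ := 0) hκ he₀0 he₁0 (fun _ => le_rfl) hδT0 he₀ he₁ (fun k => by rw [zero_mul]) hδT
  exact perturbationLaws_gaugeSlot L M a ha hu h₁' (opNorm_QuT_sub_Q1_le L M T hT)
    (fun k => (unitDatum_one L M a' ha' k).1) (fun k => (unitDatum_one L M a' ha' k).2) hsmall hGu hG₁

/-! ### §3b The site-transport binders ENTRYWISE (the field shapes of row B4.e's `SiteTransportLaws0`) -/

section Site

variable {ι : Type*} [Fintype ι] [DecidableEq ι]

/-- `‖siteMul T − 1‖ ≤ τ` from the entrywise `‖T x − 1‖ ≤ τ`. [folklore] -/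
theorem opNorm_siteMul_sub_one_le {Tx : ι → Matrix o o ℂ} {τ : ℝ} (hτ : 0 ≤ τ) (h : ∀ x, ‖Tx x - 1‖ ≤ τ) :
    ‖siteMul Tx - 1‖ ≤ τ := by
  have e : siteMul Tx - 1 = siteMul (fun x => Tx x - 1) := by rw [siteMul_sub, siteMul_one]
  rw [e]; exact opNorm_siteMul_le _ hτ h

/-- `‖siteMul v − siteMul w‖ ≤ δ` from the entrywise `‖v x − w x‖ ≤ δ`. [folklore] -/
theorem opNorm_siteMul_sub_siteMul_le {v w : ι → Matrix o o ℂ} {δ : ℝ} (hδ : 0 ≤ δ) (h : ∀ x, ‖v x - w x‖ ≤ δ) :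
    ‖siteMul v - siteMul w‖ ≤ δ := by
  rw [← siteMul_sub]; exact opNorm_siteMul_le _ hδ h

end Site

/-- **§3 WITH THE SITE-TRANSPORT BINDERS ENTRYWISE** — `‖T k x − 1‖ ≤ τ`, `‖T (k+1) x′ − T k (par x′)‖ ≤ τ′/n_k` (the field shapes of row
B4.e's announced `SiteTransportLaws0`; then `δT k = τ′·L^{−k}`, `CT = τ′`).  NOT NE2; model level. [folklore] -/
theorem perturbationLaws_gaugeSlot_scalar_site (ha' : 0 < a') (hd : 1 ≤ d)
    {A : (k : ℕ) → Matrix (Tor (fine (lev L k) M) × o) (Tor (fine (lev L (k + 1)) M) × o) ℂ}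
    {F : (k : ℕ) → Matrix (Tor (fine (lev L k) M) × o) (Tor (fine (lev L k) M) × o) ℂ} {r : ℝ} {e₀ e₁ f e₂ : ℕ → ℝ}
    {κs α β β' τ τ' C₀ C₁ C₂ : ℝ}
    (hfree : FreeTowerLaws (fun k => DeltaPs (lev L k) M a' ⊗ₖ (1 : Matrix o o ℂ)) A
      (fun k => J0pcT L M k ⊗ₖ (1 : Matrix o o ℂ)) F r e₀ e₁ f)
    (hpert : PerturbationLaws (fun k => DeltaPs (lev L k) M a' ⊗ₖ (1 : Matrix o o ℂ))
      (fun k => scalarPert (lev L k) M a' (R k) (T k)) (fun k => J0pcT L M k ⊗ₖ (1 : Matrix o o ℂ)) κs e₂)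
    (hκ : κs < 1) (hα : 0 ≤ α) (hβ : 0 ≤ β) (hβ' : 0 ≤ β') (hτ : 0 ≤ τ) (hτ' : 0 ≤ τ')
    (hR : ∀ k μ i, ‖connL (fine (lev L k) M) (cl L k) (R k) μ i‖ ≤ α)
    (hLip : ∀ k μ lam i, ‖connL (fine (lev L k) M) (cl L k) (R k) μ (tau (fine (lev L k) M) lam i)
      - connL (fine (lev L k) M) (cl L k) (R k) μ i‖ ≤ β / (lev L k : ℕ))
    (hcons : ∀ k μ (i' : Tor (fine (lev L (k + 1)) M) × Fin d),
      ‖connL (fine (lev L (k + 1)) M) (cl L (k + 1)) (R (k + 1)) μ i' - connL (fine (lev L k) M) (cl L k) (R k) μ (parT (lev L k) L M i')‖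
        ≤ β' / (lev L k : ℕ))
    (hT : ∀ k x, ‖T k x - 1‖ ≤ τ)
    (hTc : ∀ k (x' : Tor (fine (lev L (k + 1)) M)), ‖T (k + 1) x' - T k (par (lev L k) L M x')‖ ≤ τ' / (lev L k : ℕ))
    (he₀ : ∀ k, e₀ k ≤ C₀ * ((L : ℝ)⁻¹) ^ k) (he₁ : ∀ k, e₁ k ≤ C₁ * ((L : ℝ)⁻¹) ^ k) (he₂ : ∀ k, e₂ k ≤ C₂ * ((L : ℝ)⁻¹) ^ k)
    (hsmall : ((sigma0 d a') ^ 2)⁻¹ * deltaK (gS d a' κs) (1 + τ) (d * α) τ a' < 1) :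
    PerturbationLaws (fun k => calDalev L M a ha k ⊗ₖ (1 : Matrix o o ℂ)) (gaugeSlot L M R (QuT L M o T) (Q1 L M o) a')
      (fun k => JpcT L M k ⊗ₖ (1 : Matrix o o ℂ)) (kappaGS d a a' κs α τ)
      (fun k => C4S d L a a' κs α β β' τ C₀ C₁ C₂ τ' * ((L : ℝ)⁻¹) ^ k) :=
  perturbationLaws_gaugeSlot_scalar L M a ha R T a' ha' hd hfree hpert hκ hα hβ hβ' hτ hR hLip hcons
    (fun k => opNorm_siteMul_sub_one_le hτ (hT k))
    (fun k => opNorm_siteMul_sub_siteMul_le (div_nonneg hτ' (Nat.cast_nonneg _)) (hTc k))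
    he₀ he₁ he₂ (fun k => by rw [div_eq_mul_inv, inv_cast_lev]) hsmall

/-! ## §4 Row B4.d BY NAME: the free bundle from `freeTowerLaws_scalar_of_excess` -/

/-- **THE GAUGE SLOT's `PerturbationLaws` WITH ROW B4.d's FREE SCALAR TOWER BY NAME**: §3 with
`hfree := KroneckerLift.freeTowerLaws_kron o (ScalarSandwichReduction.freeTowerLaws_scalar_of_excess …)` — the `U = 1` scalar tower with
King's 0-form averagings ∕ plantings (`Q0lev`, `J0pcT`), complement defect `2d√(γ′⁻¹)·L^{−k}`, injected defect `(2d√(γ′⁻¹) + C_X)·L^{−k}`,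
CONDITIONAL on row B4.d's one displayed excess inequality `hX` (leaf-04's files 7–8 discharge it).  NOT NE2; model level. [folklore] -/
theorem perturbationLaws_gaugeSlot_of_excess (ha' : 0 < a') (hd : 1 ≤ d) {CX : ℝ} (hCX : 0 ≤ CX)
    (hX : ∀ (k : ℕ) (v : Tor (fine (lev L k) M) → ℂ),
      (star (Gps (lev L k) M a' *ᵥ v) ⬝ᵥ ((effLapLev L M k - LapS (fine (lev L k) M) ((lev L k : ℕ) : ℂ)) *ᵥ (Gps (lev L k) M a' *ᵥ v))).re
        ≤ CX * ((L : ℝ)⁻¹) ^ k * nsq v)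
    {e₂ δT : ℕ → ℝ} {κs α β β' τ C₂ CT : ℝ}
    (hpert : PerturbationLaws (fun k => DeltaPs (lev L k) M a' ⊗ₖ (1 : Matrix o o ℂ))
      (fun k => scalarPert (lev L k) M a' (R k) (T k)) (fun k => J0pcT L M k ⊗ₖ (1 : Matrix o o ℂ)) κs e₂)
    (hκ : κs < 1) (hα : 0 ≤ α) (hβ : 0 ≤ β) (hβ' : 0 ≤ β') (hτ : 0 ≤ τ)
    (hR : ∀ k μ i, ‖connL (fine (lev L k) M) (cl L k) (R k) μ i‖ ≤ α)
    (hLip : ∀ k μ lam i, ‖connL (fine (lev L k) M) (cl L k) (R k) μ (tau (fine (lev L k) M) lam i)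
      - connL (fine (lev L k) M) (cl L k) (R k) μ i‖ ≤ β / (lev L k : ℕ))
    (hcons : ∀ k μ (i' : Tor (fine (lev L (k + 1)) M) × Fin d),
      ‖connL (fine (lev L (k + 1)) M) (cl L (k + 1)) (R (k + 1)) μ i' - connL (fine (lev L k) M) (cl L k) (R k) μ (parT (lev L k) L M i')‖
        ≤ β' / (lev L k : ℕ))
    (hT : ∀ k, ‖siteMul (T k) - 1‖ ≤ τ)
    (hTc : ∀ k, ‖siteMul (T (k + 1)) - siteMul (fun x' : Tor (fine (lev L (k + 1)) M) => T k (par (lev L k) L M x'))‖ ≤ δT k)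
    (he₂ : ∀ k, e₂ k ≤ C₂ * ((L : ℝ)⁻¹) ^ k) (hδT : ∀ k, δT k ≤ CT * ((L : ℝ)⁻¹) ^ k)
    (hsmall : ((sigma0 d a') ^ 2)⁻¹ * deltaK (gS d a' κs) (1 + τ) (d * α) τ a' < 1) :
    PerturbationLaws (fun k => calDalev L M a ha k ⊗ₖ (1 : Matrix o o ℂ)) (gaugeSlot L M R (QuT L M o T) (Q1 L M o) a')
      (fun k => JpcT L M k ⊗ₖ (1 : Matrix o o ℂ)) (kappaGS d a a' κs α τ)
      (fun k => C4S d L a a' κs α β β' τ (2 * d * Real.sqrt ((gammaPs d a')⁻¹)) (2 * d * Real.sqrt ((gammaPs d a')⁻¹) + CX) C₂ CT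
        * ((L : ℝ)⁻¹) ^ k) :=
  perturbationLaws_gaugeSlot_scalar L M a ha R T a' ha' hd
    (freeTowerLaws_kron o (freeTowerLaws_scalar_of_excess L M a' (Nat.lt_of_lt_of_le Nat.zero_lt_one hd) ha' hCX hX))
    hpert hκ hα hβ hβ' hτ hR hLip hcons hT hTc (fun _ => le_rfl) (fun _ => le_rfl) he₂ hδT hsmall

end Summit.QuantumFields.BalabanUV.T4Continuum.GaugeTermInstanceGeom

end
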